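import Mathlib

/-!
# Solo-blind seat (MatrixMultiplication), s68 — the STAR FAMILY of maximum zero-sum-free sets in `𝔽₃^(r+1)`
(paper/KraftK3.md §2, paper/ZSF-classification.md, TRIANGLE.md (R18.12)–(R18.13), CLAIMS c664–c666)

The Kraft inequality (K₃) — `K_h(τ) = Σ_{T : Σ_{i∈T} h i = τ} 2^{-|T|} ≤ 1` for zero-sum-free `h` over `𝔽₃^r`,
the `𝔽₃`-skeleton of the lattice conjecture closing door I1⁗ — is TIGHT in every rank on a squarefree,
non-degenerate configuration: the star family
`T = {e_0, …, e_r} ∪ {e_0 + e_k : 1 ≤ k ≤ r} ∪ {s}`, `s = a·e_0 + e_1 + ⋯ + e_r` with `a + r = 1` in `𝔽₃`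
(`2(r+1)` terms in rank `r+1`).  This file defines the family as a sequence indexed by
`Fin (r+1) ⊕ (Fin r ⊕ Unit)` and proves that it is ZERO-SUM FREE for every `r` (so, being of length
`2·rank`, it is a zero-sum-free sequence of maximum length — Olson's bound — and for rank `≥ 3` a maximum
zero-sum-free SET).  Pen-proved, not formalised here: `Σ(T) = 𝔽₃^(r+1) ∖ {0}`, and `K_T(τ) ≤ 1` with
equality exactly at `τ = s` (closed form, CLAIMS c666); `T` is the unique indecomposable orbit in rank 3,
the unique tight residual orbit in rank 4, and the rarest of the 2646 orbits of maximum sets in rank 5.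
Pure finite combinatorics; no `ω` content by itself.
-/

set_option linter.dupNamespace false

namespace Summit.MatrixMultiplication.MatrixMultiplication.Theorems

open Finset BigOperators

section StarFamily

/-- The star family in rank `r+1`: the basis vectors `e_j` (`inl j`), the vectors `e_0 + e_{k+1}`
(`inr (inl k)`), and the apex `s = (a, 1, …, 1)` (`inr (inr ())`). -/
def soloBlindStar (r : ℕ) (a : ZMod 3) : (Fin (r+1) ⊕ (Fin r ⊕ Unit)) → (Fin (r+1) → ZMod 3)
  | Sum.inl j => Pi.single j 1
  | Sum.inr (Sum.inl k) => Pi.single 0 1 + Pi.single k.succ 1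
  | Sum.inr (Sum.inr _) => fun j => if j = 0 then a else 1

/-- Coordinate `k+1` of a star vector: `1` exactly for `e_{k+1}`, `e_0 + e_{k+1}` and `s`. -/
theorem soloBlindStar_apply_succ (r : ℕ) (a : ZMod 3) (i : Fin (r+1) ⊕ (Fin r ⊕ Unit)) (k : Fin r) :
    soloBlindStar r a i k.succ =
      (if i = Sum.inl k.succ then 1 else 0) + (if i = Sum.inr (Sum.inl k) then 1 else 0) +
        (if i = Sum.inr (Sum.inr ()) then 1 else 0) := by
  rcases i with j | k' | u
  · simp only [soloBlindStar, Pi.single_apply, Sum.inl.injEq, reduceCtorEq, if_false, add_zero]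
    by_cases h : k.succ = j
    · rw [if_pos h, if_pos h.symm]
    · rw [if_neg h, if_neg (Ne.symm h)]
  · simp only [soloBlindStar, Pi.add_apply, Pi.single_apply, Fin.succ_ne_zero, if_false, zero_add,
      Fin.succ_inj, Sum.inr.injEq, Sum.inl.injEq, reduceCtorEq, add_zero]
    by_cases h : k = k'
    · rw [if_pos h, if_pos h.symm]
    · rw [if_neg h, if_neg (Ne.symm h)]
  · cases u
    simp [soloBlindStar, Fin.succ_ne_zero]

/-- Coordinate `0` of a star vector: `1` for `e_0` and for every `e_0 + e_{k+1}`, `a` for `s`. -/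
theorem soloBlindStar_apply_zero (r : ℕ) (a : ZMod 3) (i : Fin (r+1) ⊕ (Fin r ⊕ Unit)) :
    soloBlindStar r a i 0 =
      (if i = Sum.inl 0 then 1 else 0) + (∑ k : Fin r, if i = Sum.inr (Sum.inl k) then 1 else 0) +
        (if i = Sum.inr (Sum.inr ()) then a else 0) := by
  rcases i with j | k' | u
  · simp only [soloBlindStar, Pi.single_apply, Sum.inl.injEq, reduceCtorEq, if_false,
      Finset.sum_const_zero, add_zero]
    by_cases h : (0 : Fin (r+1)) = j
    · rw [if_pos h, if_pos h.symm]
    · rw [if_neg h, if_neg (Ne.symm h)]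
  · simp only [soloBlindStar, Pi.add_apply, Pi.single_apply, if_true, (Fin.succ_ne_zero k').symm,
      if_false, add_zero, reduceCtorEq, zero_add, Sum.inr.injEq, Sum.inl.injEq]
    rw [Finset.sum_ite_eq]
    simp
  · cases u
    simp [soloBlindStar]

/-- THE STAR FAMILY IS ZERO-SUM FREE (TRIANGLE.md (R18.12), CLAIMS c666): if `a + r = 1` in `𝔽₃`
(i.e. `a ≡ 2 - rank`), no non-empty sub-family of `soloBlindStar r a` sums to zero.
Proof: a zero sub-sum not using `s` has, at each coordinate `k+1`, the value `[e_{k+1} used] + [e_0+e_{k+1} used]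
∈ {0,1,2}`, forcing both unused, and then coordinate `0` forces `e_0` unused; a zero sub-sum using `s` forces
every `e_{k+1}` and `e_0 + e_{k+1}` to be used, and then coordinate `0` reads `[e_0 used] + r + a = [e_0 used] + 1 ≠ 0`. -/
theorem soloBlind_star_zeroSumFree (r : ℕ) (a : ZMod 3) (ha : a + r = 1)
    (T : Finset (Fin (r+1) ⊕ (Fin r ⊕ Unit))) (hT : ∑ i ∈ T, soloBlindStar r a i = 0) : T = ∅ := by
  -- the coordinate equations
  have hsucc : ∀ k : Fin r,
      (if Sum.inl k.succ ∈ T then (1 : ZMod 3) else 0) + (if Sum.inr (Sum.inl k) ∈ T then 1 else 0) +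
        (if Sum.inr (Sum.inr ()) ∈ T then 1 else 0) = 0 := by
    intro k
    have h := congrFun hT k.succ
    rw [Finset.sum_apply, Pi.zero_apply] at h
    simp_rw [soloBlindStar_apply_succ] at h
    rwa [Finset.sum_add_distrib, Finset.sum_add_distrib, Finset.sum_ite_eq', Finset.sum_ite_eq',
      Finset.sum_ite_eq'] at h
  have hzero : (if Sum.inl 0 ∈ T then (1 : ZMod 3) else 0) +
      (∑ k : Fin r, if Sum.inr (Sum.inl k) ∈ T then 1 else 0) +
        (if Sum.inr (Sum.inr ()) ∈ T then a else 0) = 0 := by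
    have h := congrFun hT 0
    rw [Finset.sum_apply, Pi.zero_apply] at h
    simp_rw [soloBlindStar_apply_zero] at h
    rw [Finset.sum_add_distrib, Finset.sum_add_distrib, Finset.sum_ite_eq', Finset.sum_ite_eq',
      Finset.sum_comm] at h
    simp_rw [Finset.sum_ite_eq'] at h
    exact h
  by_cases hz : Sum.inr (Sum.inr ()) ∈ T
  · -- the apex is used: every e_{k+1} and e_0 + e_{k+1} is used, and coordinate 0 is contradictory
    exfalso
    have hy : ∀ k : Fin r, Sum.inr (Sum.inl k) ∈ T := by
      intro k
      have h := hsucc k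
      rw [if_pos hz] at h
      by_contra hk
      rw [if_neg hk] at h
      split_ifs at h <;> exact absurd h (by decide)
    simp only [hy, if_true, Finset.sum_const, Finset.card_univ, Fintype.card_fin, nsmul_eq_mul,
      mul_one, hz] at hzero
    have h2 : (if Sum.inl 0 ∈ T then (1 : ZMod 3) else 0) + 1 = 0 := by
      linear_combination hzero - ha
    split_ifs at h2 <;> exact absurd h2 (by decide)
  · -- the apex is not used: nothing is used
    have hx : ∀ k : Fin r, Sum.inl k.succ ∉ T ∧ Sum.inr (Sum.inl k) ∉ T := by
      intro k
      have h := hsucc k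
      rw [if_neg hz] at h
      by_cases h1 : Sum.inl k.succ ∈ T <;> by_cases h2 : Sum.inr (Sum.inl k) ∈ T <;>
        simp only [h1, h2, if_true, if_false] at h ⊢
      · exact absurd h (by decide)
      · exact absurd h (by decide)
      · exact absurd h (by decide)
      · exact ⟨not_false, not_false⟩
    have h0 : Sum.inl 0 ∉ T := by
      intro h0
      have h := hzero
      rw [if_pos h0, if_neg hz] at h
      have hs : (∑ k : Fin r, if Sum.inr (Sum.inl k) ∈ T then (1 : ZMod 3) else 0) = 0 :=
        Finset.sum_eq_zero fun k _ => if_neg (hx k).2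
      rw [hs] at h
      exact absurd h (by decide)
    apply Finset.eq_empty_of_forall_notMem
    intro x
    rcases x with j | k | u
    · rcases Fin.eq_zero_or_eq_succ j with rfl | ⟨k, rfl⟩
      · exact h0
      · exact (hx k).1
    · exact (hx k).2
    · cases u
      exact hz

/-- In particular every star vector is non-zero (take the singleton sub-family). -/
theorem soloBlindStar_ne_zero (r : ℕ) (a : ZMod 3) (ha : a + r = 1) (i : Fin (r+1) ⊕ (Fin r ⊕ Unit)) :
    soloBlindStar r a i ≠ 0 := by
  intro h
  have := soloBlind_star_zeroSumFree r a ha {i} (by rw [Finset.sum_singleton, h])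
  exact absurd this (Finset.singleton_ne_empty i)

/-- For rank `r+1 ≥ 3` the `2(r+1)` star vectors are pairwise distinct, so the star family is a zero-sum-free
SET of size `2·rank`, the maximum size of a zero-sum-free subset of `𝔽₃^(r+1)`. -/
theorem soloBlindStar_injective (r : ℕ) (a : ZMod 3) (hr : 2 ≤ r) :
    Function.Injective (soloBlindStar r a) := by
  intro i i' h
  have hs : ∀ k : Fin r, soloBlindStar r a i k.succ = soloBlindStar r a i' k.succ := fun k => by rw [h]
  have h0 : soloBlindStar r a i 0 = soloBlindStar r a i' 0 := by rw [h]
  -- `e_{k+1}` differs from the apex at coordinate 1 (if k ≠ 0) or 2 (if k = 0); same for `e_0 + e_{k+1}`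
  have key : ∀ k : Fin r, (∀ k'' : Fin r, k'' ≠ k →
      soloBlindStar r a (Sum.inr (Sum.inr ())) k''.succ = (Pi.single k.succ (1 : ZMod 3) : Fin (r+1) → ZMod 3) k''.succ) → False := by
    intro k hk
    by_cases hk0 : k = ⟨0, by omega⟩
    · have h1 := hk ⟨1, by omega⟩ (by rw [hk0]; simp [Fin.ext_iff])
      simp [soloBlindStar, Fin.ext_iff, hk0] at h1
    · have h1 := hk ⟨0, by omega⟩ (Ne.symm hk0)
      simp [soloBlindStar, Pi.single_apply] at h1
      apply hk0
      rw [Fin.ext_iff] at h1 ⊢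
      simp only [Fin.val_succ] at h1 ⊢
      omega
  rcases i with j | k | u <;> rcases i' with j' | k' | u'
  · -- e_j = e_j'
    have hj := congrFun h j
    simp only [soloBlindStar, Pi.single_apply, if_true] at hj
    by_cases hjj : j = j'
    · rw [hjj]
    · rw [if_neg hjj] at hj
      exact absurd hj (by decide)
  · exfalso
    rcases Fin.eq_zero_or_eq_succ j with rfl | ⟨k, rfl⟩
    · have h1 := hs k'
      simp [soloBlindStar] at h1
    · have h1 := h0
      simp [soloBlindStar] at h1
  · exfalso
    rcases Fin.eq_zero_or_eq_succ j with rfl | ⟨k, rfl⟩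
    · have h1 := hs ⟨0, by omega⟩
      simp [soloBlindStar] at h1
    · exact key k fun k'' _ => by rw [← hs k'']; simp [soloBlindStar]
  · exfalso
    rcases Fin.eq_zero_or_eq_succ j' with rfl | ⟨k', rfl⟩
    · have h1 := hs k
      simp [soloBlindStar] at h1
    · have h1 := h0
      simp [soloBlindStar] at h1
  · -- e_0 + e_{k+1} = e_0 + e_{k'+1}
    have h1 := hs k
    simp only [soloBlindStar, Pi.add_apply, Pi.single_apply, Fin.succ_ne_zero, if_false, zero_add,
      if_true, Fin.succ_inj] at h1
    by_cases hkk : k = k'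
    · rw [hkk]
    · rw [if_neg hkk] at h1
      exact absurd h1 (by decide)
  · exfalso
    exact key k fun k'' hk'' => by
      rw [← hs k'']
      simp [soloBlindStar, Fin.succ_ne_zero, hk'']
  · exfalso
    rcases Fin.eq_zero_or_eq_succ j' with rfl | ⟨k', rfl⟩
    · have h1 := hs ⟨0, by omega⟩
      simp [soloBlindStar] at h1
    · exact key k' fun k'' _ => by rw [hs k'']; simp [soloBlindStar]
  · exfalso
    exact key k' fun k'' hk'' => by
      rw [hs k'']
      simp [soloBlindStar, Fin.succ_ne_zero, hk'']
  · cases u; cases u'; rfl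

end StarFamily

end Summit.MatrixMultiplication.MatrixMultiplication.Theorems
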